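import Summits.QuantumAdvantage.AdviceFreeQNC0.ProductBound
import Summits.QuantumAdvantage.AdviceFreeQNC0.LDMATransfer
import HarnessLib

/-!
# Cell qa-qnc0 (rung F-Q1, route RingFrame, crux α, line `product`): ADDITIVE LDMA suffices for the
# product bound

Planner qa-qnc0-p1's TARGET §20.7 / `Sketch8b.lean`, ask P6a, typed verbatim and PROVED:
`productHard_of_ldmaAddSuff_of_elimHard` (= `Sketch8b.ProductOfLDMAAdd`): LDMA with an ADDITIVE
error `E·2^{L+L'}` whose error/constant ratio is an arbitrarily small constant (`LDMAAddSuff`), and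
elimination hardness, give the product bound `ProductHardPolylog` (body verbatim) with `μ = κη₀/2` —
the mechanical re-run of `productHard_of_ldma_of_elimHard` (`ProductBound.lean`): the three
per-residue LDMA applications carry an additive error `E·2^{L+L'}` each, and `3E = κη₀/2` at
`E = κη₀/6`.  READING: the crux lives at CONSTANT relative distance — rows nearer than `τ·2^{L'}` to
the fail code may be dropped at additive cost (the level-set chain `FW ⟹ FSB ⟹ LDMAAdd` is in
`LevelSetTransfer.lean`).  Vocabulary `LDMAAdd`, `LDMAAddSuff` verbatim from `Sketch8b`; `cls` is the
cell topic's (`LDMATransfer.lean`).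

WHAT THIS IS NOT: `LDMAAdd` for general column degree is OPEN; nothing on α; no separation claim.
-/

noncomputable section

namespace Summit.QuantumAdvantage.AdviceFreeQNC0

open Finset
open Literature.Computability.MetaComplexity Literature.Computability.MetaComplexity.Smolensky

/-! ### Vocabulary (verbatim from `Sketch8b`) -/

/-- **Additive LDMA**: class `r` carries a `κ`-fraction of the total cost up to `E·2^{L+L'}`. -/
def LDMAAdd (κ E : ℝ) : Prop :=
  ∀ C : ℕ, ∃ L₀ : ℕ, ∀ L L' : ℕ, L₀ ≤ L → L₀ ≤ L' → ∀ D : ℕ, D ≤ (Nat.log 2 (min L L')) ^ C →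
    ∀ Γ : (Fin L → Bool) → (Fin L' → Bool) → Bool, (∀ v, HasDeg (fun u => Γ u v) D) → ∀ r : ℕ,
      κ * ((∑ u : Fin L → Bool, distFail D (Γ u) : ℕ) : ℝ) ≤
        ((∑ u ∈ cls L r, distFail D (Γ u) : ℕ) : ℝ) + E * (2 : ℝ) ^ (L + L')

/-- The form sufficient for the product bound: error/constant ratio arbitrarily small. -/
def LDMAAddSuff : Prop := ∀ ε : ℝ, 0 < ε → ∃ κ : ℝ, 0 < κ ∧ LDMAAdd κ (ε * κ)

/-! ### P6a: additive LDMA suffices for the product bound -/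

/-- **Additive LDMA and elimination hardness give the product bound** (`Sketch8b.ProductOfLDMAAdd`;
bodies of `ElimHard` and `ProductHardPolylog` verbatim), `μ = κη₀/2` with `κ = κ(ε)` at `ε = η₀/6`.
Mechanical re-run of `productHard_of_ldma_of_elimHard`: the three per-residue LDMA applications now
carry an additive error `E·2^{L+L'}` each, `3E = κη₀/2`. -/
theorem productHard_of_ldmaAddSuff_of_elimHard (hL : LDMAAddSuff)
    (hE : ∃ η₀ : ℝ, 0 < η₀ ∧ ∀ C : ℕ, ∃ n₀ : ℕ, ∀ n ≥ n₀, ∀ a b : CubeFn (ZMod 2) n,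
      a ∈ lowDeg (ZMod 2) n ((Nat.log 2 n) ^ C) → b ∈ lowDeg (ZMod 2) n ((Nat.log 2 n) ^ C) →
        ∀ dec : ZMod 2 → ZMod 2 → ℕ,
          η₀ * (2 : ℝ) ^ n ≤ ((univ.filter fun u : Fin n → Bool =>
            dec (a u) (b u) % 3 = Hegedus.wt u % 3).card : ℝ)) :
    ∃ μ : ℝ, 0 < μ ∧ ∀ C : ℕ, ∃ L₀ : ℕ, ∀ L L' : ℕ, L₀ ≤ L → L₀ ≤ L' →
      ∀ X Y : (Fin L → Bool) → (Fin L' → Bool) → Bool,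
        (∀ v, IsElimWin ((Nat.log 2 (min L L')) ^ C) (fun u => X u v)) →
        (∀ u, IsElimWin ((Nat.log 2 (min L L')) ^ C) (fun v => Y u v)) →
          μ * (2 : ℝ) ^ (L + L') ≤ (agreeCountR X Y : ℝ) := by
  obtain ⟨η₀, hη₀, hEl⟩ := hE
  obtain ⟨κ, hκ, hLD⟩ := hL (η₀ / 6) (by positivity)
  refine ⟨κ * η₀ / 2, by positivity, fun C => ?_⟩
  obtain ⟨L₁, hL₁⟩ := hLD C
  obtain ⟨n₀, hn₀⟩ := hEl C
  refine ⟨max L₁ n₀, fun L L' hL hL' X Y hX hY => ?_⟩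
  set D := (Nat.log 2 (min L L')) ^ C with hD
  -- Alice's class-0 stakes, column by column
  have hXc : ∀ v, ∃ ab : ((Fin L → Bool) → Bool) × ((Fin L → Bool) → Bool),
      HasDeg ab.1 D ∧ HasDeg ab.2 D ∧ ∀ u, X u v = !(elimFail 0 ab.1 ab.2 u) := fun v => by
    obtain ⟨a, b, ha, hb, h⟩ := isElimWin_class0 (hX v)
    exact ⟨(a, b), ha, hb, h⟩
  choose ab hab using hXc
  -- the zero-sum triple as maps `Γ r : u ↦ g_r(u, ·)`
  set Γ : Fin 3 → (Fin L → Bool) → (Fin L' → Bool) → Bool :=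
    fun r u v => triple r ((ab v).1 u) ((ab v).2 u) with hΓ
  have hΓdeg : ∀ r v, HasDeg (fun u => Γ r u v) D := by
    intro r v
    simp only [hΓ, triple]
    split_ifs
    · exact (hab v).2.1
    · exact (hab v).1
    · exact hasDeg_xor (hab v).1 (hab v).2.1
  have hXΓ : ∀ u v, X u v = Γ (resLabel u) u v := fun u v => by
    rw [(hab v).2.2 u]
    unfold elimFail
    rw [win_eq_triple]
  -- Bob's fail pattern in row `u`
  have hYf : ∀ u, IsElimFail D (fun v => !(Y u v)) := by
    intro u
    obtain ⟨c, a, b, ha, hb, h⟩ := hY u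
    refine ⟨c, a, b, ha, hb, fun v => ?_⟩
    have hv : Y u v = !elimFail c a b v := h v
    show (!Y u v) = elimFail c a b v
    rw [hv, Bool.not_not]
  -- row decomposition
  have hrow : ∀ u, distFail D (Γ (resLabel u) u) ≤ (univ.filter fun v => X u v = Y u v).card := by
    intro u
    refine le_trans (distFail_le _ (hYf u)) (le_of_eq ?_)
    unfold hdist
    congr 1
    ext v
    simp only [mem_filter, mem_univ, true_and, hXΓ u v]
    cases Γ (resLabel u) u v <;> cases Y u v <;> decide
  have hagree : agreeCountR X Y = ∑ u, (univ.filter fun v => X u v = Y u v).card := by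
    unfold agreeCountR
    exact card_filter_prod_eq_sum (fun u v => X u v = Y u v)
  -- additive LDMA, one residue at a time
  have hLr : ∀ r : Fin 3, κ * ∑ u : Fin L → Bool, (distFail D (Γ r u) : ℝ) ≤
      (∑ u ∈ univ.filter (fun u => resLabel u = r), (distFail D (Γ r u) : ℝ)) +
        η₀ / 6 * κ * (2 : ℝ) ^ (L + L') := by
    intro r
    have h := hL₁ L L' (le_trans (le_max_left _ _) hL) (le_trans (le_max_left _ _) hL') D le_rfl
      (Γ r) (fun v => hΓdeg r v) ((3 - r.val) % 3)
    have hset : cls L ((3 - r.val) % 3) = univ.filter fun u => resLabel u = r := by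
      unfold cls
      ext u
      simp only [mem_filter, mem_univ, true_and, resLabel, Fin.ext_iff]
      have := r.isLt
      omega
    rw [hset] at h
    push_cast at h
    exact h
  -- potential costs and the minimum fail weight
  have hpc : ∀ u : Fin L → Bool, (distFail D (fun _ : Fin L' → Bool => false) : ℝ) ≤
      (distFail D (Γ 0 u) : ℝ) + distFail D (Γ 1 u) + distFail D (Γ 2 u) := fun u => by
    exact_mod_cast potential_cost D _ _ _ fun v => triple_sum ((ab v).1 u) ((ab v).2 u)
  have hw : η₀ * (2 : ℝ) ^ L' ≤ (distFail D (fun _ : Fin L' → Bool => false) : ℝ) :=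
    le_distFail_zero hn₀ (le_trans (le_max_right _ _) hL')
      (Nat.pow_le_pow_left (Nat.log_mono_right (min_le_right L L')) C)
  -- assembling the chain
  have h1 : (∑ u : Fin L → Bool, (distFail D (Γ (resLabel u) u) : ℝ)) ≤ (agreeCountR X Y : ℝ) := by
    rw [hagree]
    push_cast
    exact Finset.sum_le_sum fun u _ => by exact_mod_cast hrow u
  have h2 : (∑ u : Fin L → Bool, (distFail D (Γ (resLabel u) u) : ℝ)) =
      ∑ r : Fin 3, ∑ u ∈ univ.filter (fun u => resLabel u = r), (distFail D (Γ r u) : ℝ) := by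
    rw [← Finset.sum_fiberwise_of_maps_to (s := (univ : Finset (Fin L → Bool))) (t := (univ : Finset (Fin 3)))
      (g := resLabel) (fun u _ => mem_univ _) (f := fun u => (distFail D (Γ (resLabel u) u) : ℝ))]
    refine Finset.sum_congr rfl fun r _ => Finset.sum_congr rfl fun u hu => ?_
    rw [(Finset.mem_filter.1 hu).2]
  have h4 : ∑ r : Fin 3, ∑ u : Fin L → Bool, (distFail D (Γ r u) : ℝ) =
      ∑ u : Fin L → Bool, ((distFail D (Γ 0 u) : ℝ) + distFail D (Γ 1 u) + distFail D (Γ 2 u)) := by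
    rw [Finset.sum_comm]
    refine Finset.sum_congr rfl fun u _ => ?_
    rw [Fin.sum_univ_three]
  have hcard : (∑ _u : Fin L → Bool, (distFail D (fun _ : Fin L' → Bool => false) : ℝ)) =
      (2 : ℝ) ^ L * (distFail D (fun _ : Fin L' → Bool => false) : ℝ) := by
    rw [Finset.sum_const, card_univ, Fintype.card_fun, Fintype.card_bool, Fintype.card_fin,
      nsmul_eq_mul]
    push_cast
    ring
  have herr : ∑ _r : Fin 3, η₀ / 6 * κ * (2 : ℝ) ^ (L + L') = κ * η₀ / 2 * (2 : ℝ) ^ (L + L') := by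
    rw [Finset.sum_const, card_univ, Fintype.card_fin, nsmul_eq_mul]
    push_cast
    ring
  have hchain : κ * η₀ * (2 : ℝ) ^ (L + L') ≤ (agreeCountR X Y : ℝ) + κ * η₀ / 2 * (2 : ℝ) ^ (L + L') :=
    calc κ * η₀ * (2 : ℝ) ^ (L + L')
        = κ * ((2 : ℝ) ^ L * (η₀ * (2 : ℝ) ^ L')) := by rw [pow_add]; ring
      _ ≤ κ * ((2 : ℝ) ^ L * (distFail D (fun _ : Fin L' → Bool => false) : ℝ)) := by
          have h2L : (0 : ℝ) ≤ (2 : ℝ) ^ L := by positivity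
          exact mul_le_mul_of_nonneg_left (mul_le_mul_of_nonneg_left hw h2L) hκ.le
      _ = κ * ∑ _u : Fin L → Bool, (distFail D (fun _ : Fin L' → Bool => false) : ℝ) := by rw [hcard]
      _ ≤ κ * ∑ u : Fin L → Bool, ((distFail D (Γ 0 u) : ℝ) + distFail D (Γ 1 u) + distFail D (Γ 2 u)) :=
          mul_le_mul_of_nonneg_left (Finset.sum_le_sum fun u _ => hpc u) hκ.le
      _ = ∑ r : Fin 3, κ * ∑ u : Fin L → Bool, (distFail D (Γ r u) : ℝ) := by
          rw [← h4, Finset.mul_sum]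
      _ ≤ ∑ r : Fin 3, ((∑ u ∈ univ.filter (fun u => resLabel u = r), (distFail D (Γ r u) : ℝ)) +
            η₀ / 6 * κ * (2 : ℝ) ^ (L + L')) := Finset.sum_le_sum fun r _ => hLr r
      _ = (∑ u : Fin L → Bool, (distFail D (Γ (resLabel u) u) : ℝ)) + κ * η₀ / 2 * (2 : ℝ) ^ (L + L') := by
          rw [Finset.sum_add_distrib, ← h2, herr]
      _ ≤ (agreeCountR X Y : ℝ) + κ * η₀ / 2 * (2 : ℝ) ^ (L + L') := by linarith [h1]
  linarith [hchain]

end Summit.QuantumAdvantage.AdviceFreeQNC0
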